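import Summits.HodgeConjecture.HodgeConjecture.Theses.HeckePrymWeil
import Literature.AlgebraicGeometry.Motives.AbelianVarietyProjectiveChart

/-!
# `WeilSixfoldsSqrtMinus7` (stmt-HodgeConjecture-1260) · Negative · eigenvalue bookkeeping and summit-hardness

Negative-side knowledge for the crux `HeckePrymWeil.WeilSixfoldsSqrtMinus7` (Hodge–Weil classes are
algebraic on every complex abelian sixfold `A` with `φ ∈ End A`, `φ ∘ φ = -7`), extracted from the
standing disprover's work file `Cruxes/WeilSixfoldsSqrtMinus7/Disproof.lean`
(refuter-cdisprove-stmt-HodgeConjecture-1260-0, cycle 1, 2026-08-16) so that ideators, planners and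
provers can import them. All theorems are unconditional and definition-free; none asserts a Theses
decl.

* **Eigenvalue separation** (the typing of the Weil plane is right). The crux renders
  `W_K ⊗ ℂ = ∧⁶H¹_σ ⊕ ∧⁶H¹_σ̄` as `Eig((𝟙+φ)^*, (1+i√7)⁶) ⊔ Eig((𝟙+φ)^*, (1-i√7)⁶)`; on the
  Künneth–Hodge summand `∧ᵃH¹_σ ⊗ ∧ᵇH¹_σ̄` of `H⁶ = ∧⁶H¹` the pull-back `(𝟙+φ)^* = ∧⁶(1 + φ^*|H¹)`
  acts by `(1+i√7)ᵃ(1-i√7)ᵇ`. For any `t` with `t² = -7` we prove `(1 ± t)⁶ = 288 ± 160 t`,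
  `(1+t)ᵇ ≠ (1-t)ᵇ` for `1 ≤ b ≤ 6`, hence `(1+t)⁶ ≠ (1-t)⁶` and NO mixed `(a, b)` (`a + b = 6`)
  shares the eigenvalue of either Weil line; and `(1+t)⁶` is not real, so `(𝟙+φ)^*` has no rational
  eigenvector in `W_K` (one non-zero algebraic class in `W_K` spans it over `ℚ[(𝟙+φ)^*] ≅ K`).
* **Rational description of the Weil plane.** `mem_weilPlane_iff`: for any `ℂ`-linear `f`,
  `x ∈ Eig(f,(1+i√7)⁶) ⊔ Eig(f,(1-i√7)⁶) ↔ f(f x) - 576·f x + 262144·x = 0`; `T² - 576T + 8⁶` is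
  irreducible over `ℚ` (discriminant `-7·320²`), so `W` is the kernel of a `ℚ`-rational operator.
* **Summit-hardness of refutation.** `not_hodgeConjecture_of_not_weilSixfoldsSqrtMinus7`: abelian
  varieties are smooth projective of dimension `dim A` (PROVED in the tree,
  `AbelianVariety.isSmoothProjective_holds`), so a counterexample to the crux is a counterexample to
  `HodgeConjecture` itself (and, by André 1996 — barrier
  `Literature.Barriers.HodgeConjecture.MotivatedClassesAbelianVarieties` — to the standard conjecture
  of Lefschetz type); `not_hodgeWeilLadder_of_…`: the crux is the rung `(7,2)` of the route target.
  Status in print (2026-08-16): only the discriminant `-1` (split) component is known (Markman,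
  arXiv:2502.03415; survey arXiv:2509.23403 Thm. 1.2); "outside this locus, the Hodge conjecture for
  Weil classes on sixfolds remains completely open" (arXiv:2603.20268, §1).
-/

noncomputable section

open CategoryTheory Complex

namespace Summit.HodgeConjecture.HodgeConjecture.Theorems.WeilSixfoldsSqrtMinus7.Negative

open Summit.HodgeConjecture.HodgeConjecture.Theses.HeckePrymWeil

/-! ## Read-back -/

/-- READ-BACK of the crux, symbol by symbol: for every complex abelian variety `A` of dimension `6`
and every `φ : A ⟶ A` with `φ ≫ φ = -(7 • 𝟙 A)`, every rational class of Hodge type `(3,3)` in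
`H⁶(A(ℂ); ℂ)` lying in the sum of the `(1 ± i√7)⁶`-eigenspaces of the pull-back `(𝟙 + φ)^*` is in
`algebraicClasses A.X 3 = N³H⁶`. Definitional (`Iff.rfl`). [folklore] -/
theorem weilSixfoldsSqrtMinus7_iff : WeilSixfoldsSqrtMinus7 ↔
    ∀ (A : Literature.AlgebraicGeometry.Motives.AbelianVariety ℂ) (φ : A ⟶ A), A.dim = 6 →
      φ ≫ φ = -((7 : ℤ) • 𝟙 A) →
      ∀ c : Literature.AlgebraicGeometry.HodgeTheory.complexBetti A.X 6,
        Literature.AlgebraicGeometry.HodgeTheory.IsRationalClass c →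
        Literature.AlgebraicGeometry.HodgeTheory.IsOfHodgeType 6 A.X 6 3 3 c →
        c ∈ Module.End.eigenspace (Literature.AlgebraicGeometry.HodgeTheory.complexBetti.map
              (𝟙 A + φ).hom.hom.hom 6).hom ((1 + I * (Real.sqrt (7 : ℝ) : ℂ)) ^ 6) ⊔
            Module.End.eigenspace (Literature.AlgebraicGeometry.HodgeTheory.complexBetti.map
              (𝟙 A + φ).hom.hom.hom 6).hom ((1 - I * (Real.sqrt (7 : ℝ) : ℂ)) ^ 6) →
        c ∈ Literature.AlgebraicGeometry.HodgeTheory.algebraicClasses A.X 3 :=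
  Iff.rfl

/-! ## Arithmetic of `1 ± t`, `t² = -7` -/

section SqrtMinusSeven

variable {t : ℂ}

/-- `(1 + t)⁶ = 288 + 160 t` when `t² = -7`. [folklore] -/
theorem one_add_pow_six (ht : t ^ 2 = -7) : (1 + t) ^ 6 = 288 + 160 * t := by
  linear_combination (-41 - 22 * t + 8 * t ^ 2 + 6 * t ^ 3 + t ^ 4) * ht

/-- `(1 - t)⁶ = 288 - 160 t` when `t² = -7`. [folklore] -/
theorem one_sub_pow_six (ht : t ^ 2 = -7) : (1 - t) ^ 6 = 288 - 160 * t := by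
  linear_combination (-41 + 22 * t + 8 * t ^ 2 - 6 * t ^ 3 + t ^ 4) * ht

/-- `t ≠ 0` when `t² = -7`. [folklore] -/
theorem ne_zero_of_sq (ht : t ^ 2 = -7) : t ≠ 0 := by
  rintro rfl
  norm_num at ht

/-- `1 + t ≠ 0` when `t² = -7` (`(1+t)(1-t) = 8`). [folklore] -/
theorem one_add_ne_zero (ht : t ^ 2 = -7) : 1 + t ≠ 0 := by
  intro h0
  have h1 : (1 + t) * (1 - t) = 8 := by linear_combination -ht
  rw [h0, zero_mul] at h1
  norm_num at h1

/-- `1 - t ≠ 0` when `t² = -7`. [folklore] -/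
theorem one_sub_ne_zero (ht : t ^ 2 = -7) : 1 - t ≠ 0 := by
  intro h0
  have h1 : (1 + t) * (1 - t) = 8 := by linear_combination -ht
  rw [h0, mul_zero] at h1
  norm_num at h1

/-- `(1+t)ᵇ ≠ (1-t)ᵇ` for `1 ≤ b ≤ 6` when `t² = -7`: `(1+t)ᵇ - (1-t)ᵇ = 2 B_b t` with
`B_b = 1, 2, -4, -24, -16, 160 ≠ 0` (`(1+√-7)ᵇ = A_b + B_b √-7`). [folklore] -/
theorem one_add_pow_ne_one_sub_pow (ht : t ^ 2 = -7) :
    ∀ b : ℕ, 1 ≤ b → b ≤ 6 → (1 + t) ^ b ≠ (1 - t) ^ b := by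
  intro b h1 h6 h
  have ht0 : t ≠ 0 := ne_zero_of_sq ht
  interval_cases b
  · have hz : (2 : ℂ) * t = 0 := by linear_combination h
    rcases mul_eq_zero.1 hz with hk | hk
    · norm_num at hk
    · exact ht0 hk
  · have hz : (4 : ℂ) * t = 0 := by linear_combination h
    rcases mul_eq_zero.1 hz with hk | hk
    · norm_num at hk
    · exact ht0 hk
  · have hz : (-8 : ℂ) * t = 0 := by linear_combination h - (2 * t) * ht
    rcases mul_eq_zero.1 hz with hk | hk
    · norm_num at hk
    · exact ht0 hk
  · have hz : (-48 : ℂ) * t = 0 := by linear_combination h - (8 * t) * ht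
    rcases mul_eq_zero.1 hz with hk | hk
    · norm_num at hk
    · exact ht0 hk
  · have hz : (-32 : ℂ) * t = 0 := by linear_combination h - (6 * t + 2 * t ^ 3) * ht
    rcases mul_eq_zero.1 hz with hk | hk
    · norm_num at hk
    · exact ht0 hk
  · have hz : (320 : ℂ) * t = 0 := by linear_combination h - (-44 * t + 12 * t ^ 3) * ht
    rcases mul_eq_zero.1 hz with hk | hk
    · norm_num at hk
    · exact ht0 hk

/-- The two Weil eigenvalues differ: `(1+t)⁶ ≠ (1-t)⁶` (`t² = -7`). [folklore] -/
theorem one_add_pow_six_ne (ht : t ^ 2 = -7) : (1 + t) ^ 6 ≠ (1 - t) ^ 6 :=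
  one_add_pow_ne_one_sub_pow ht 6 (by norm_num) le_rfl

/-- No mixed Künneth–Hodge summand `∧ᵃH¹_σ ⊗ ∧ᵇH¹_σ̄` (`a + b = 6`, `b ≠ 0`) carries the eigenvalue
of the Weil line `∧⁶H¹_σ`: `(1+t)ᵃ(1-t)ᵇ ≠ (1+t)⁶`. [folklore] -/
theorem mixed_ne_one_add_pow_six (ht : t ^ 2 = -7) {a b : ℕ} (hab : a + b = 6) (hb : b ≠ 0) :
    (1 + t) ^ a * (1 - t) ^ b ≠ (1 + t) ^ 6 := by
  intro h
  rw [← hab, pow_add] at h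
  have h' : (1 - t) ^ b = (1 + t) ^ b :=
    mul_left_cancel₀ (pow_ne_zero a (one_add_ne_zero ht)) h
  exact one_add_pow_ne_one_sub_pow ht b (Nat.pos_of_ne_zero hb) (by omega) h'.symm

/-- Symmetrically for the conjugate Weil line: `(1+t)ᵃ(1-t)ᵇ ≠ (1-t)⁶` for `a ≠ 0`. [folklore] -/
theorem mixed_ne_one_sub_pow_six (ht : t ^ 2 = -7) {a b : ℕ} (hab : a + b = 6) (ha : a ≠ 0) :
    (1 + t) ^ a * (1 - t) ^ b ≠ (1 - t) ^ 6 := by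
  intro h
  rw [← hab, pow_add] at h
  have h' : (1 + t) ^ a = (1 - t) ^ a :=
    mul_right_cancel₀ (pow_ne_zero b (one_sub_ne_zero ht)) h
  exact one_add_pow_ne_one_sub_pow ht a (Nat.pos_of_ne_zero ha) (by omega) h'

/-- The Weil eigenvalue `(1+t)⁶ = 288 + 160 t` is not real (`t² = -7 < 0`). [folklore] -/
theorem one_add_pow_six_ne_ofReal (ht : t ^ 2 = -7) (r : ℝ) : (1 + t) ^ 6 ≠ (r : ℂ) := by
  intro h
  rw [one_add_pow_six ht] at h
  have h1 : t = (((r - 288) / 160 : ℝ) : ℂ) := by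
    push_cast
    linear_combination (1 / 160 : ℂ) * h
  rw [h1] at ht
  have h2 : (((r - 288) / 160) ^ 2 : ℝ) = -7 := by exact_mod_cast ht
  nlinarith [sq_nonneg ((r - 288) / 160)]

/-- For scalars `μ ≠ ν` and a `ℂ`-linear endomorphism `f`:
`x ∈ Eig(f, μ) ⊔ Eig(f, ν) ↔ f (f x) - (μ + ν) • f x + (μ ν) • x = 0` (kernel of a product of two
coprime linear factors; elementary). [folklore] -/
theorem mem_eigenspace_sup_eigenspace_iff {V : Type*} [AddCommGroup V] [Module ℂ V]
    (f : Module.End ℂ V) {μ ν : ℂ} (hμν : μ ≠ ν) (x : V) :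
    x ∈ f.eigenspace μ ⊔ f.eigenspace ν ↔ f (f x) - (μ + ν) • f x + (μ * ν) • x = 0 := by
  constructor
  · intro hx
    obtain ⟨a, ha, b, hb, rfl⟩ := Submodule.mem_sup.1 hx
    rw [Module.End.mem_eigenspace_iff] at ha hb
    simp only [map_add, ha, hb, map_smul]
    module
  · intro h
    have hd : (μ - ν) ≠ 0 := sub_ne_zero.2 hμν
    have hffx : f (f x) = (μ + ν) • f x - (μ * ν) • x := by
      rw [← sub_eq_zero, ← h]
      module
    set a : V := (μ - ν)⁻¹ • (f x - ν • x) with ha_def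
    have hfx : f x = (μ - ν) • a + ν • x := by
      rw [ha_def, smul_smul, mul_inv_cancel₀ hd, one_smul]
      module
    have hfa : f a = μ • a := by
      rw [ha_def, map_smul, map_sub, map_smul, hffx]
      module
    refine Submodule.mem_sup.2 ⟨a, Module.End.mem_eigenspace_iff.2 hfa, x - a, ?_, add_sub_cancel a x⟩
    rw [Module.End.mem_eigenspace_iff, map_sub, hfa, hfx]
    module

/-- The sum of the two Weil eigenspaces is the kernel of `f² - 576 f + 262144` (`t² = -7`):
`λ + λ̄ = 576`, `λ λ̄ = 8⁶`. [folklore] -/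
theorem mem_eigenspace_sup_iff_of_sq (ht : t ^ 2 = -7) {V : Type*} [AddCommGroup V] [Module ℂ V]
    (f : Module.End ℂ V) (x : V) :
    x ∈ f.eigenspace ((1 + t) ^ 6) ⊔ f.eigenspace ((1 - t) ^ 6) ↔
      f (f x) - (576 : ℂ) • f x + (262144 : ℂ) • x = 0 := by
  have hsum : (1 + t) ^ 6 + (1 - t) ^ 6 = 576 := by
    rw [one_add_pow_six ht, one_sub_pow_six ht]; ring
  have hprod : (1 + t) ^ 6 * (1 - t) ^ 6 = 262144 := by
    rw [one_add_pow_six ht, one_sub_pow_six ht]; linear_combination (-25600 : ℂ) * ht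
  rw [mem_eigenspace_sup_eigenspace_iff f (one_add_pow_six_ne ht), hsum, hprod]

end SqrtMinusSeven

/-! ## The crux's atom `t = i√7` -/

/-- `(i√7)² = -7`. [folklore] -/
theorem I_mul_sqrt_seven_sq : (I * (Real.sqrt (7 : ℝ) : ℂ)) ^ 2 = -7 := by
  rw [mul_pow, Complex.I_sq, ← Complex.ofReal_pow, Real.sq_sqrt (by norm_num : (0 : ℝ) ≤ 7)]
  push_cast
  ring

/-- **The two Weil eigenvalues of the crux are distinct**: `(1+i√7)⁶ ≠ (1-i√7)⁶`, so the `⊔` in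
the crux is a direct sum of two different eigenspaces of `(𝟙+φ)^*`. [folklore] -/
theorem weilEigenvalue_pos_ne_neg :
    (1 + I * (Real.sqrt (7 : ℝ) : ℂ)) ^ 6 ≠ (1 - I * (Real.sqrt (7 : ℝ) : ℂ)) ^ 6 :=
  one_add_pow_six_ne I_mul_sqrt_seven_sq

/-- Explicit values: `(1 ± i√7)⁶ = 288 ± 160·i√7`. [folklore] -/
theorem weilEigenvalue_values :
    (1 + I * (Real.sqrt (7 : ℝ) : ℂ)) ^ 6 = 288 + 160 * (I * (Real.sqrt (7 : ℝ) : ℂ)) ∧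
    (1 - I * (Real.sqrt (7 : ℝ) : ℂ)) ^ 6 = 288 - 160 * (I * (Real.sqrt (7 : ℝ) : ℂ)) :=
  ⟨one_add_pow_six I_mul_sqrt_seven_sq, one_sub_pow_six I_mul_sqrt_seven_sq⟩

/-- **No mixed summand `(a, b)`, `a + b = 6`, `b ≠ 0`, has the eigenvalue `(1+i√7)⁶` of the Weil
line `∧⁶H¹_σ`.** [folklore] -/
theorem mixed_eigenvalue_ne_pos {a b : ℕ} (hab : a + b = 6) (hb : b ≠ 0) :
    (1 + I * (Real.sqrt (7 : ℝ) : ℂ)) ^ a * (1 - I * (Real.sqrt (7 : ℝ) : ℂ)) ^ b ≠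
      (1 + I * (Real.sqrt (7 : ℝ) : ℂ)) ^ 6 :=
  mixed_ne_one_add_pow_six I_mul_sqrt_seven_sq hab hb

/-- **No mixed summand `(a, b)`, `a + b = 6`, `a ≠ 0`, has the eigenvalue `(1-i√7)⁶` of the
conjugate Weil line `∧⁶H¹_σ̄`.** [folklore] -/
theorem mixed_eigenvalue_ne_neg {a b : ℕ} (hab : a + b = 6) (ha : a ≠ 0) :
    (1 + I * (Real.sqrt (7 : ℝ) : ℂ)) ^ a * (1 - I * (Real.sqrt (7 : ℝ) : ℂ)) ^ b ≠
      (1 - I * (Real.sqrt (7 : ℝ) : ℂ)) ^ 6 :=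
  mixed_ne_one_sub_pow_six I_mul_sqrt_seven_sq hab ha

/-- The Weil eigenvalue is not real: `(𝟙+φ)^*` has no rational (indeed no real) eigenvector in the
Weil plane. [folklore] -/
theorem weilEigenvalue_ne_ofReal (r : ℝ) : (1 + I * (Real.sqrt (7 : ℝ) : ℂ)) ^ 6 ≠ (r : ℂ) :=
  one_add_pow_six_ne_ofReal I_mul_sqrt_seven_sq r

/-- **The Weil plane is cut out by a RATIONAL operator identity**: for any `ℂ`-linear `f` (in the
crux: `f = (𝟙+φ)^*` on `H⁶(A(ℂ); ℂ)`),
`x ∈ Eig(f, (1+i√7)⁶) ⊔ Eig(f, (1-i√7)⁶) ↔ f(f x) - 576·f x + 262144·x = 0`. Since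
`T² - 576T + 262144 ∈ ℤ[T]` is irreducible over `ℚ` (discriminant `576² - 4·8⁶ = -7·320²`), the Weil
plane is defined over `ℚ` and functorial under maps commuting with `(𝟙+φ)^*` — the form in which
descending / product arguments use it. [folklore] -/
theorem mem_weilPlane_iff {V : Type*} [AddCommGroup V] [Module ℂ V] (f : Module.End ℂ V) (x : V) :
    x ∈ f.eigenspace ((1 + I * (Real.sqrt (7 : ℝ) : ℂ)) ^ 6) ⊔
        f.eigenspace ((1 - I * (Real.sqrt (7 : ℝ) : ℂ)) ^ 6) ↔
      f (f x) - (576 : ℂ) • f x + (262144 : ℂ) • x = 0 :=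
  mem_eigenspace_sup_iff_of_sq I_mul_sqrt_seven_sq f x

/-! ## Summit-hardness: any kill of the crux kills `HodgeConjecture` -/

/-- **A counterexample to the crux is a counterexample to the Hodge conjecture.** Abelian varieties
are smooth projective geometrically irreducible of dimension `dim A`
(`AbelianVariety.isSmoothProjective_holds`, PROVED in the tree), so `HodgeConjecture` yields
`HodgeConjectureFor 6 A.X` for every sixfold and in particular the crux (the eigenspace and `φ`
hypotheses are not even used). Contrapositive form, so that no Theses decl is asserted. With
André 1996 (barrier `MotivatedClassesAbelianVarieties`) such a counterexample would moreover refute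
the standard conjecture of Lefschetz type. [folklore] -/
theorem not_hodgeConjecture_of_not_weilSixfoldsSqrtMinus7 (hnot : ¬ WeilSixfoldsSqrtMinus7) :
    ¬ _root_.HodgeConjecture := by
  intro hHC
  apply hnot
  intro A φ hdim _hφ c hrat hhodge _heig
  have hsp : Literature.AlgebraicGeometry.Motives.IsSmoothProjective 6 A.X := by
    have h := (Literature.AlgebraicGeometry.Motives.AbelianVariety.isSmoothProjective_holds (A := A))
    rw [Literature.AlgebraicGeometry.Motives.AbelianVariety.isSmoothProjective, hdim] at h
    exact h
  exact (hHC hsp).2 3 c hrat hhodge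

/-- **The crux is the rung `(p, g') = (7, 2)` of the route target `HodgeWeilLadder`**
(`n = (7-1)/2 · (2-1) = 3`, dimension `2n = 6`): a counterexample to the crux refutes the target.
[folklore] -/
theorem not_hodgeWeilLadder_of_not_weilSixfoldsSqrtMinus7 (hnot : ¬ WeilSixfoldsSqrtMinus7) :
    ¬ HodgeWeilLadder := by
  intro hL
  apply hnot
  intro A φ hdim hφ c hrat hhodge heig
  have h := hL 7 (by norm_num) (by norm_num) (by norm_num) 2 (by norm_num) 3 (by norm_num) A φ
    hdim (by exact_mod_cast hφ) c hrat hhodge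
  exact h (by exact_mod_cast heig)

end Summit.HodgeConjecture.HodgeConjecture.Theorems.WeilSixfoldsSqrtMinus7.Negative

end
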